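import Mathlib
import HarnessLib

/-!
# Route `IntegerScrew` — the TRANSFER LEMMA of harmonic transfer (CONTINUUM-LIMIT 16.1 / PIVOT-LAW 13.44)

THEOREM C♯ (PIVOT-LAW §13.44) and THEOREM C♭ (§13.46) bound the return probability of the truncated
multiplicative walk by comparing it with an explicit «almost space-time harmonic» function.  The comparison
step is the following elementary lemma (CONTINUUM-LIMIT 16.1): if a non-negative kernel `P_s(x₀, ·)` solves the
forward equation `∂_s P_s(x₀,y) = Σ_z P_s(x₀,z) Q(z,y)` with `P_0(x₀,·) = δ_{x₀}`, and a time-dependent function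
`f(u;·) ≥ 0`-or-not satisfies the pointwise generator inequality `(Qf)(u;z) − ∂_u f(u;z) ≤ β f(u;z)` for
`u ∈ (0, τ]`, then `m(s) := Σ_y P_s(x₀,y) f(τ−s; y)` obeys `m′ ≤ βm` on `[0,τ)` and hence (Grönwall)

  `Σ_y P_τ(x₀,y) f(0;y) ≤ e^{βτ} f(τ; x₀)`;

and symmetrically `≥ e^{−βτ} f(τ;x₀)` when `(Qf) − ∂_u f ≥ −βf`.  With `f(0;·) = 𝟙[· = 1]` the left side is
the return probability `P_{x₀}(X_τ = 1)`.  The lemma is stated here for an ARBITRARY finite index type and an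
abstract kernel `P` given with its forward equation (for a finite Markov chain `P_s = e^{sQ}`; that
instantiation is not part of this file), so that it serves 16.1 (C♯, both directions) and the Duhamel variant
18.3 (C♭) alike.  Pure calculus (finite sums, product rule, Grönwall's inequality in Mathlib's form
`le_gronwallBound_of_liminf_deriv_right_le`); RH-free and walk-free.  Nothing here bears on the truth of RH.
References: PIVOT-LAW §13.44, CONTINUUM-LIMIT §16.1, §21.1 (K1) (rh-explicit, A6-PIVOT theory); M. Suzuki,
J. Lond. Math. Soc. (2) 108 (2023) 1448–1487 [Suzuki2023] for the screw matrices whose pivot law this serves.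
-/

noncomputable section

-- D-0017: `Summit.<S>.<S>.…` is the designed namespace of a single-problem summit.
set_option linter.dupNamespace false

namespace Summit.RiemannHypothesis.RiemannHypothesis.Theorems.IntegerScrew

open Finset Real Set Filter Topology

variable {ι : Type*} [Fintype ι] [DecidableEq ι]

omit [DecidableEq ι] in
/-- Rearrangement of the derivative of `m(s) = Σ_y P(y) f(y)`: `Σ_y [(Σ_z P z·Q z y)·f y − P y·f′ y]
= Σ_z P z·[(Σ_y Q z y·f y) − f′ z]`. -/
theorem transfer_sum_rearrange (P : ι → ℝ) (Q : ι → ι → ℝ) (g g' : ι → ℝ) :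
    (∑ y, ((∑ z, P z * Q z y) * g y + P y * (-(g' y)))) =
      ∑ z, P z * ((∑ y, Q z y * g y) - g' z) := by
  have h1 : (∑ y, (∑ z, P z * Q z y) * g y) = ∑ z, P z * ∑ y, Q z y * g y := by
    simp_rw [Finset.sum_mul, Finset.mul_sum]
    rw [Finset.sum_comm]
    refine Finset.sum_congr rfl fun z _ => Finset.sum_congr rfl fun y _ => ?_
    ring
  rw [Finset.sum_add_distrib, h1, ← Finset.sum_add_distrib]
  refine Finset.sum_congr rfl fun z _ => ?_
  ring

/-- **TRANSFER LEMMA, upper direction** (CONTINUUM-LIMIT 16.1).  Hypotheses: `P 0 x₀ · = δ_{x₀}`; the row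
`s ↦ P s x₀ y` is non-negative on `[0,τ)`, continuous on `[0,τ]` and solves the forward equation
`∂_s P s x₀ y = Σ_z P s x₀ z · Q z y` on `[0,τ)`; `u ↦ f u y` is continuous on `[0,τ]` with derivative `f′ u y`
on `(0,τ]`; and the generator inequality `Σ_y Q z y·f u y − f′ u z ≤ β·f u z` holds for `u ∈ (0,τ]`.
Conclusion: `Σ_y P τ x₀ y · f 0 y ≤ e^{βτ} · f τ x₀`. -/
theorem harmonicTransfer_le (P : ℝ → ι → ι → ℝ) (Q : ι → ι → ℝ) (x₀ : ι) (f f' : ℝ → ι → ℝ)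
    {τ β : ℝ} (hτ : 0 ≤ τ)
    (hP0 : ∀ y, P 0 x₀ y = if y = x₀ then 1 else 0)
    (hPnn : ∀ s ∈ Ico 0 τ, ∀ y, 0 ≤ P s x₀ y)
    (hPcont : ∀ y, ContinuousOn (fun s => P s x₀ y) (Icc 0 τ))
    (hPderiv : ∀ s ∈ Ico 0 τ, ∀ y, HasDerivAt (fun s => P s x₀ y) (∑ z, P s x₀ z * Q z y) s)
    (hfcont : ∀ y, ContinuousOn (fun u => f u y) (Icc 0 τ))
    (hfderiv : ∀ u ∈ Ioc 0 τ, ∀ y, HasDerivAt (fun u => f u y) (f' u y) u)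
    (hineq : ∀ u ∈ Ioc 0 τ, ∀ z, (∑ y, Q z y * f u y) - f' u z ≤ β * f u z) :
    ∑ y, P τ x₀ y * f 0 y ≤ Real.exp (β * τ) * f τ x₀ := by
  set m : ℝ → ℝ := fun s => ∑ y, P s x₀ y * f (τ - s) y with hm
  set m' : ℝ → ℝ := fun s => ∑ z, P s x₀ z * ((∑ y, Q z y * f (τ - s) y) - f' (τ - s) z) with hm'
  have hm0 : m 0 = f τ x₀ := by
    simp only [hm, hP0, sub_zero, ite_mul, one_mul, zero_mul, Finset.sum_ite_eq', Finset.mem_univ,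
      if_true]
  have hmτ : m τ = ∑ y, P τ x₀ y * f 0 y := by simp only [hm, sub_self]
  have hcont : ContinuousOn m (Icc 0 τ) := by
    refine continuousOn_finsetSum _ fun y _ => (hPcont y).mul ?_
    refine (hfcont y).comp (continuous_const.sub continuous_id).continuousOn fun s hs => ?_
    simp only [Set.mem_Icc] at hs ⊢
    constructor <;> linarith
  have hderiv : ∀ s ∈ Ico 0 τ, HasDerivAt m (m' s) s := by
    intro s hs
    have hu : τ - s ∈ Ioc 0 τ := by
      simp only [Set.mem_Ico] at hs
      simp only [Set.mem_Ioc]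
      constructor <;> linarith
    have hsum : HasDerivAt m
        (∑ y, ((∑ z, P s x₀ z * Q z y) * f (τ - s) y + P s x₀ y * (-(f' (τ - s) y)))) s := by
      refine HasDerivAt.fun_sum fun y _ => ?_
      have h2 : HasDerivAt (fun r : ℝ => f (τ - r) y) (-(f' (τ - s) y)) s := by
        have hlin : HasDerivAt (fun r : ℝ => τ - r) (-1) s := by
          simpa using (hasDerivAt_id' s).const_sub τ
        have hc := (hfderiv (τ - s) hu y).comp s hlin
        refine (hc.congr_of_eventuallyEq (Eventually.of_forall fun r => rfl)).congr_deriv ?_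
        ring
      exact (hPderiv s hs y).mul h2
    refine hsum.congr_deriv ?_
    rw [hm']
    exact transfer_sum_rearrange (fun z => P s x₀ z) Q (fun y => f (τ - s) y) (fun y => f' (τ - s) y)
  have hbound : ∀ s ∈ Ico 0 τ, m' s ≤ β * m s + 0 := by
    intro s hs
    have hu : τ - s ∈ Ioc 0 τ := by
      simp only [Set.mem_Ico] at hs
      simp only [Set.mem_Ioc]
      constructor <;> linarith
    rw [add_zero, hm', hm]
    simp only
    rw [Finset.mul_sum]
    refine Finset.sum_le_sum fun z _ => ?_
    have h1 := hineq (τ - s) hu z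
    have h2 := hPnn s hs z
    calc P s x₀ z * ((∑ y, Q z y * f (τ - s) y) - f' (τ - s) z)
        ≤ P s x₀ z * (β * f (τ - s) z) := mul_le_mul_of_nonneg_left h1 h2
      _ = β * (P s x₀ z * f (τ - s) z) := by ring
  have hslope : ∀ s ∈ Ico 0 τ, ∀ r, m' s < r → ∃ᶠ z in 𝓝[>] s, (z - s)⁻¹ * (m z - m s) < r := by
    intro s hs r hr
    have h := ((hderiv s hs).hasDerivWithinAt (s := Ici s)).liminf_right_slope_le hr
    exact h.mono fun z hz => by simpa only [slope_def_field, div_eq_inv_mul] using hz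
  have hG := le_gronwallBound_of_liminf_deriv_right_le hcont hslope (le_refl (m 0)) hbound τ
    ⟨hτ, le_rfl⟩
  rw [gronwallBound_ε0, sub_zero, hm0, hmτ] at hG
  linarith [hG, mul_comm (f τ x₀) (Real.exp (β * τ))]

/-- **TRANSFER LEMMA, lower direction**: under the same hypotheses with the generator inequality reversed,
`Σ_y Q z y·f u y − f′ u z ≥ −β·f u z` on `(0,τ]`, one has `Σ_y P τ x₀ y · f 0 y ≥ e^{−βτ} · f τ x₀`
(apply the upper direction to `−f` with `−β`). -/
theorem harmonicTransfer_ge (P : ℝ → ι → ι → ℝ) (Q : ι → ι → ℝ) (x₀ : ι) (f f' : ℝ → ι → ℝ)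
    {τ β : ℝ} (hτ : 0 ≤ τ)
    (hP0 : ∀ y, P 0 x₀ y = if y = x₀ then 1 else 0)
    (hPnn : ∀ s ∈ Ico 0 τ, ∀ y, 0 ≤ P s x₀ y)
    (hPcont : ∀ y, ContinuousOn (fun s => P s x₀ y) (Icc 0 τ))
    (hPderiv : ∀ s ∈ Ico 0 τ, ∀ y, HasDerivAt (fun s => P s x₀ y) (∑ z, P s x₀ z * Q z y) s)
    (hfcont : ∀ y, ContinuousOn (fun u => f u y) (Icc 0 τ))
    (hfderiv : ∀ u ∈ Ioc 0 τ, ∀ y, HasDerivAt (fun u => f u y) (f' u y) u)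
    (hineq : ∀ u ∈ Ioc 0 τ, ∀ z, -(β * f u z) ≤ (∑ y, Q z y * f u y) - f' u z) :
    Real.exp (-(β * τ)) * f τ x₀ ≤ ∑ y, P τ x₀ y * f 0 y := by
  have h := harmonicTransfer_le P Q x₀ (fun u y => -f u y) (fun u y => -f' u y) (β := -β) hτ hP0 hPnn
    hPcont hPderiv (fun y => (hfcont y).neg) (fun u hu y => (hfderiv u hu y).neg) ?_
  · have e1 : (∑ y, P τ x₀ y * -f 0 y) = -∑ y, P τ x₀ y * f 0 y := by
      rw [← Finset.sum_neg_distrib]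
      exact Finset.sum_congr rfl fun y _ => by ring
    rw [e1, neg_mul, mul_neg] at h
    linarith
  · intro u hu z
    have h1 := hineq u hu z
    have e3 : (∑ y, Q z y * -f u y) = -∑ y, Q z y * f u y := by
      rw [← Finset.sum_neg_distrib]
      exact Finset.sum_congr rfl fun y _ => by ring
    rw [e3]
    linarith

end Summit.RiemannHypothesis.RiemannHypothesis.Theorems.IntegerScrew

end
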